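import Summits.ValiantsHypothesis.ValiantsHypothesis.Theorems.LacunarySymmetroidMatrixDescartesCensusEdgeTwoNine

/-!
# `MatrixDescartes` census — W4: the runs lemma past a common zero (divisor form), sign-block counts, and the twist of the edge `1..9`

HONEST FRAMING.  Object-search cell `pub-symmetroid`, item `DoorA26 = PosRootLawAt 2 6 19` (stmt-ValiantsHypothesis-19979,
OPEN, typed, never asserted).  W4 line (engine-1 g17–g21): degenerations of HYPOTHETICAL Descartes-sharp symmetric `2 × 2`
six-term pencils.  Tools for THEOREM R3c (edge `1..9`, companion file `…CensusEdgeOneNine`): (i) the RUNS LEMMA of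
`…CensusEdgeTwoNine` re-proved in DIVISOR FORM — for `W = p·F′ − 2p′·F ≠ 0` and any `F₁ ≠ 0` whose positive zeros are zeros of `F`
off the zeros of `p` (multiplicities not larger), `#Z₊^{mult}(F₁) ≤ #Z₊^{mult}(W) + #Z₊^{mult}(p) + 1` (Rolle for `F/p²` between
consecutive zeros of `F₁`, zeros of `p` as the other separators) — which survives a common zero of `F` and `p` by taking
`F₁ = F /ₘ (X − τ)`; (ii) Descartes sign-block counts `Var ≤ 3` (four blocks) and `Var ≤ 1` (two blocks) via the tree's
`signVariations_succ_le_of_blocks`; (iii) the explicit 6-nomial `X·W` for `R = β₁X^{d₁} + β₂X^{d₂} + β₃X^{d₃}`,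
`p = y₁X^{d₁} + y₂X^{d₂} + y₃X^{d₃}`.  Nothing here bounds `ζ_sym(2,6)`, decides `DoorA26`, or bears on the crux
`MatrixDescartes` (stmt-ValiantsHypothesis-18050) / `VP ≠ VNP`.

[folklore] Rolle with multiplicity + Descartes' rule of signs; no single source.
-/

-- `Summit.ValiantsHypothesis.ValiantsHypothesis.…` repeats a component by the D-0017 layout
-- (single-conjunct summit), which the `dupNamespace` linter flags; the name is mandated.
set_option linter.dupNamespace false

namespace Summit.ValiantsHypothesis.ValiantsHypothesis.Theorems.LacunarySymmetroidMatrixDescartes.Census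

open Polynomial Finset Set
open scoped BigOperators Polynomial

/-! ### The runs lemma for a divisor, past a common zero of `F` and `p` -/

/-- A root of multiplicity `m` of `F` is a root of multiplicity at least `m − 1` of `W = p·F′ − 2p′·F`. [folklore] -/
theorem rootMultiplicity_le_of_sqTwist_eq (F p W : ℝ[X]) (x : ℝ) (hWdef : W = p * derivative F - 2 * derivative p * F)
    (hW : W ≠ 0) : F.rootMultiplicity x ≤ W.rootMultiplicity x + 1 := by
  have h1 : (X - C x) ^ (F.rootMultiplicity x - 1) ∣ derivative F := by
    rcases eq_or_ne (derivative F) 0 with hd | hd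
    · rw [hd]; exact dvd_zero _
    · exact (le_rootMultiplicity_iff hd).mp (rootMultiplicity_sub_one_le_derivative_rootMultiplicity _ x)
  have h2 : (X - C x) ^ (F.rootMultiplicity x - 1) ∣ F :=
    (pow_dvd_pow _ (Nat.sub_le _ _)).trans (pow_rootMultiplicity_dvd _ x)
  have h3 : (X - C x) ^ (F.rootMultiplicity x - 1) ∣ W := by
    rw [hWdef]
    exact dvd_sub (dvd_mul_of_dvd_right h1 _) (dvd_mul_of_dvd_right h2 _)
  have := (le_rootMultiplicity_iff hW).mpr h3
  omega

/-- **Runs lemma, divisor form.**  Let `F, p` be real polynomials and `W = p·F′ − 2p′·F ≠ 0`.  Let `F₁ ≠ 0` be a real polynomial whose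
positive zeros are zeros of `F` at which `p ≠ 0`, with `rootMultiplicity x F₁ ≤ rootMultiplicity x F` there (e.g. `F₁ = F`, or
`F₁ = F /ₘ (X − τ)`).  Then `#Z₊^{mult}(F₁) ≤ #Z₊^{mult}(W) + #Z₊^{mult}(p) + 1`: between consecutive positive zeros of `F₁` lies a
zero of `p` or (Rolle for `F/p²`) a zero of `W`. [folklore] -/
theorem countP_posRoots_le_of_sqTwist (F F₁ p W : ℝ[X]) (hWdef : W = p * derivative F - 2 * derivative p * F) (hW : W ≠ 0)
    (hF₁ : F₁ ≠ 0) (hsub : ∀ x : ℝ, 0 < x → F₁.IsRoot x → F.IsRoot x ∧ p.eval x ≠ 0)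
    (hmul : ∀ x : ℝ, 0 < x → F₁.IsRoot x → F₁.rootMultiplicity x ≤ F.rootMultiplicity x) :
    F₁.roots.countP (fun x => 0 < x) ≤ W.roots.countP (fun x => 0 < x) + p.roots.countP (fun x => 0 < x) + 1 := by
  classical
  have hp : p ≠ 0 := by
    rintro rfl
    apply hW
    rw [hWdef]; simp
  have hG : W * p ≠ 0 := mul_ne_zero hW hp
  -- multiplicities
  have hmult : ∀ x ∈ F₁.roots.toFinset.filter (fun x => 0 < x),
      F₁.rootMultiplicity x ≤ (W * p).rootMultiplicity x + 1 := by
    intro x hx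
    simp only [Finset.mem_filter, Multiset.mem_toFinset, mem_roots hF₁] at hx
    rw [rootMultiplicity_mul hG]
    have h1 := rootMultiplicity_le_of_sqTwist_eq F p W x hWdef hW
    have h2 := hmul x hx.2 hx.1
    omega
  -- interleaving
  have hinter : (F₁.roots.toFinset.filter (fun x => 0 < x)).card ≤
      (((W * p).roots.toFinset.filter (fun x => 0 < x)) \ (F₁.roots.toFinset.filter (fun x => 0 < x))).card + 1 := by
    refine Finset.card_le_sdiff_of_interleaved fun a ha b hb hab _ => ?_
    simp only [Finset.mem_filter, Multiset.mem_toFinset, mem_roots hF₁] at ha hb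
    obtain ⟨hFa', ha0⟩ := ha
    obtain ⟨hFb', hb0⟩ := hb
    obtain ⟨hFa, hpa⟩ := hsub a ha0 hFa'
    obtain ⟨hFb, hpb⟩ := hsub b hb0 hFb'
    rw [IsRoot.def] at hFa hFb
    -- target membership, unfolded
    have goal_of : ∀ z, a < z → z < b → (W.eval z = 0 ∨ p.eval z = 0) →
        ∃ z ∈ (W * p).roots.toFinset.filter (fun x => 0 < x), a < z ∧ z < b := by
      intro z haz hzb hz
      refine ⟨z, ?_, haz, hzb⟩
      simp only [Finset.mem_filter, Multiset.mem_toFinset, mem_roots hG, IsRoot.def, eval_mul]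
      refine ⟨?_, ha0.trans haz⟩
      rcases hz with h | h
      · rw [h, zero_mul]
      · rw [h, mul_zero]
    by_cases hpz : ∃ z, a < z ∧ z < b ∧ p.eval z = 0
    · obtain ⟨z, haz, hzb, hz⟩ := hpz
      exact goal_of z haz hzb (Or.inr hz)
    · push Not at hpz
      have hpne : ∀ u ∈ Icc a b, p.eval u ≠ 0 := by
        intro u hu
        rcases eq_or_lt_of_le hu.1 with h | h
        · rw [← h]; exact hpa
        rcases eq_or_lt_of_le hu.2 with h' | h'
        · rw [h']; exact hpb
        exact hpz u h h'
      -- Rolle for `φ = F / p²` on `[a, b]`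
      have hder : ∀ u ∈ Ioo a b, HasDerivAt (fun u => F.eval u * (p.eval u ^ 2)⁻¹)
          ((derivative F).eval u * (p.eval u ^ 2)⁻¹ +
            F.eval u * (-(((2 : ℕ) : ℝ) * p.eval u ^ (2 - 1) * (derivative p).eval u) / (p.eval u ^ 2) ^ 2)) u := by
        intro u hu
        have hpu : p.eval u ≠ 0 := hpne u ⟨hu.1.le, hu.2.le⟩
        refine (F.hasDerivAt u).mul ?_
        exact ((p.hasDerivAt u).pow 2).inv (pow_ne_zero 2 hpu)
      have hcont : ContinuousOn (fun u => F.eval u * (p.eval u ^ 2)⁻¹) (Icc a b) := by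
        refine F.continuousOn.mul ((p.continuousOn.pow 2).inv₀ ?_)
        intro u hu; exact pow_ne_zero 2 (hpne u hu)
      obtain ⟨z, hz, hz0⟩ := exists_hasDerivAt_eq_zero hab hcont (by simp [hFa, hFb]) hder
      have hpz0 : p.eval z ≠ 0 := hpne z ⟨hz.1.le, hz.2.le⟩
      refine goal_of z hz.1 hz.2 (Or.inl ?_)
      have key : (derivative F).eval z * p.eval z - 2 * (derivative p).eval z * F.eval z = 0 := by
        have hp2 : p.eval z ^ 2 ≠ 0 := pow_ne_zero 2 hpz0
        have e : ((derivative F).eval z * (p.eval z ^ 2)⁻¹ +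
            F.eval z * (-(((2 : ℕ) : ℝ) * p.eval z ^ (2 - 1) * (derivative p).eval z) / (p.eval z ^ 2) ^ 2))
              * (p.eval z) ^ 3
            = (derivative F).eval z * p.eval z - 2 * (derivative p).eval z * F.eval z := by
          field_simp
          ring
        rw [hz0, zero_mul] at e
        exact e.symm
      rw [hWdef, eval_sub, eval_mul, eval_mul, eval_mul, eval_ofNat]
      linarith [key]
  have main := countP_posRoots_add_le_of_interleaved F₁ (W * p) hG 0 hmult (by rw [add_zero]; exact hinter)
  rw [add_zero, roots_mul hG, Multiset.countP_add] at main
  exact main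

/-! ### Sign-block counts -/

/-- **Four sign blocks ⇒ at most three sign variations.**  Coefficients at six exponents `e₀ < e₁ < e₂ ≤ e₃ < e₄ ≤ e₅` with weights
`w₀ ≥ 0`, `w₁ ≤ 0`, `w₂, w₃ ≥ 0`, `w₄, w₅ ≤ 0` give `Var ≤ 3` (blocks `[0,e₁) | [e₁,e₂) | [e₂,e₄) | [e₄,e₅]`). [folklore] -/
theorem signVariations_le_three_of_four_blocks (Q : ℝ[X]) (e₀ e₁ e₂ e₃ e₄ e₅ : ℕ) (w₀ w₁ w₂ w₃ w₄ w₅ : ℝ)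
    (h01 : e₀ < e₁) (h12 : e₁ < e₂) (h23 : e₂ ≤ e₃) (h34 : e₃ < e₄) (h45 : e₄ ≤ e₅)
    (hcoeff : ∀ m, Q.coeff m = (if m = e₀ then w₀ else 0) + (if m = e₁ then w₁ else 0) + (if m = e₂ then w₂ else 0)
      + (if m = e₃ then w₃ else 0) + (if m = e₄ then w₄ else 0) + (if m = e₅ then w₅ else 0))
    (hw₀ : 0 ≤ w₀) (hw₁ : w₁ ≤ 0) (hw₂ : 0 ≤ w₂) (hw₃ : 0 ≤ w₃) (hw₄ : w₄ ≤ 0) (hw₅ : w₅ ≤ 0)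
    (hdeg : Q.natDegree < e₅ + 1) : Q.signVariations ≤ 3 := by
  have key := signVariations_succ_le_of_blocks 4 Q
    (fun k => if k < 1 then 0 else if k < 2 then e₁ else if k < 3 then e₂ else if k < 4 then e₄ else e₅ + 1)
    (if_pos (by norm_num)) ?_ ?_ ?_
  · omega
  · refine monotone_nat_of_le_succ fun k => ?_
    rcases Nat.lt_or_ge k 4 with hk | hk
    · interval_cases k
      · simp
      · simp; omega
      · simp; omega
      · simp; omega
    · simp only [if_neg (show ¬ k < 1 by omega), if_neg (show ¬ k < 2 by omega), if_neg (show ¬ k < 3 by omega),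
        if_neg (show ¬ k < 4 by omega), if_neg (show ¬ k + 1 < 1 by omega), if_neg (show ¬ k + 1 < 2 by omega),
        if_neg (show ¬ k + 1 < 3 by omega), if_neg (show ¬ k + 1 < 4 by omega)]
      exact le_rfl
  · simp only [show ¬ (4 : ℕ) < 1 by norm_num, show ¬ (4 : ℕ) < 2 by norm_num, show ¬ (4 : ℕ) < 3 by norm_num,
      lt_irrefl, if_false]
    exact hdeg
  · intro i hi
    interval_cases i
    · refine ⟨1, Or.inl rfl, fun m _ hm2 => ?_⟩
      simp only [show (0 : ℕ) + 1 < 2 by norm_num, show ¬ (0 : ℕ) + 1 < 1 by norm_num, if_true, if_false] at hm2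
      rw [hcoeff m, if_neg (show m ≠ e₁ by omega), if_neg (show m ≠ e₂ by omega), if_neg (show m ≠ e₃ by omega),
        if_neg (show m ≠ e₄ by omega), if_neg (show m ≠ e₅ by omega)]
      split_ifs <;> nlinarith
    · refine ⟨-1, Or.inr rfl, fun m hm1 hm2 => ?_⟩
      simp only [show (1 : ℕ) < 2 by norm_num, show ¬ (1 : ℕ) < 1 by norm_num, if_true, if_false] at hm1
      simp only [show ¬ (1 : ℕ) + 1 < 2 by norm_num, show ¬ (1 : ℕ) + 1 < 1 by norm_num, show (1:ℕ) + 1 < 3 by norm_num,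
        if_true, if_false] at hm2
      rw [hcoeff m, if_neg (show m ≠ e₀ by omega), if_neg (show m ≠ e₂ by omega), if_neg (show m ≠ e₃ by omega),
        if_neg (show m ≠ e₄ by omega), if_neg (show m ≠ e₅ by omega)]
      split_ifs <;> nlinarith
    · refine ⟨1, Or.inl rfl, fun m hm1 hm2 => ?_⟩
      simp only [show ¬ (2 : ℕ) < 2 by norm_num, show ¬ (2 : ℕ) < 1 by norm_num, show (2:ℕ) < 3 by norm_num,
        if_true, if_false] at hm1
      simp only [show ¬ (2 : ℕ) + 1 < 2 by norm_num, show ¬ (2 : ℕ) + 1 < 1 by norm_num, show ¬ (2:ℕ) + 1 < 3 by norm_num,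
        show (2:ℕ) + 1 < 4 by norm_num, if_true, if_false] at hm2
      rw [hcoeff m, if_neg (show m ≠ e₀ by omega), if_neg (show m ≠ e₁ by omega), if_neg (show m ≠ e₄ by omega),
        if_neg (show m ≠ e₅ by omega)]
      split_ifs <;> nlinarith
    · refine ⟨-1, Or.inr rfl, fun m hm1 _ => ?_⟩
      simp only [show ¬ (3 : ℕ) < 2 by norm_num, show ¬ (3 : ℕ) < 1 by norm_num, show ¬ (3:ℕ) < 3 by norm_num,
        show (3:ℕ) < 4 by norm_num, if_true, if_false] at hm1
      rw [hcoeff m, if_neg (show m ≠ e₀ by omega), if_neg (show m ≠ e₁ by omega), if_neg (show m ≠ e₂ by omega),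
        if_neg (show m ≠ e₃ by omega)]
      split_ifs <;> nlinarith

/-- **Two sign blocks ⇒ at most one sign variation** (three exponents `e₀ < e₁ ≤ e₂`, weights `w₀ ≤ 0 ≤ w₁, w₂`). [folklore] -/
theorem signVariations_le_one_of_two_blocks (Q : ℝ[X]) (e₀ e₁ e₂ : ℕ) (w₀ w₁ w₂ : ℝ) (h01 : e₀ < e₁) (h12 : e₁ ≤ e₂)
    (hcoeff : ∀ m, Q.coeff m = (if m = e₀ then w₀ else 0) + (if m = e₁ then w₁ else 0) + (if m = e₂ then w₂ else 0))
    (hw₀ : w₀ ≤ 0) (hw₁ : 0 ≤ w₁) (hw₂ : 0 ≤ w₂) (hdeg : Q.natDegree < e₂ + 1) : Q.signVariations ≤ 1 := by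
  have key := signVariations_succ_le_of_blocks 2 Q (fun k => if k < 1 then 0 else if k < 2 then e₁ else e₂ + 1)
    (if_pos (by norm_num)) ?_ ?_ ?_
  · omega
  · refine monotone_nat_of_le_succ fun k => ?_
    rcases Nat.lt_or_ge k 2 with hk | hk
    · interval_cases k
      · simp
      · simp; omega
    · simp only [if_neg (show ¬ k < 1 by omega), if_neg (show ¬ k < 2 by omega), if_neg (show ¬ k + 1 < 1 by omega),
        if_neg (show ¬ k + 1 < 2 by omega)]
      exact le_rfl
  · simp only [show ¬ (2 : ℕ) < 1 by norm_num, lt_irrefl, if_false]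
    exact hdeg
  · intro i hi
    interval_cases i
    · refine ⟨-1, Or.inr rfl, fun m _ hm2 => ?_⟩
      simp only [show (0 : ℕ) + 1 < 2 by norm_num, show ¬ (0 : ℕ) + 1 < 1 by norm_num, if_true, if_false] at hm2
      rw [hcoeff m, if_neg (show m ≠ e₁ by omega), if_neg (show m ≠ e₂ by omega)]
      split_ifs <;> nlinarith
    · refine ⟨1, Or.inl rfl, fun m hm1 _ => ?_⟩
      simp only [show (1 : ℕ) < 2 by norm_num, show ¬ (1 : ℕ) < 1 by norm_num, if_true, if_false] at hm1
      rw [hcoeff m, if_neg (show m ≠ e₀ by omega)]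
      split_ifs <;> nlinarith

/-! ### The twist of the edge `1..9` -/

/-- The 6-nomial `X·W` of the edge `1..9` (`R = β₁X^{d₁} + β₂X^{d₂} + β₃X^{d₃}`, `p = y₁X^{d₁} + y₂X^{d₂} + y₃X^{d₃}`,
`W = p·R′ − 2R·p′`). [folklore] -/
theorem X_mul_sqTwist_edge_1_9 (d₁ d₂ d₃ : ℕ) (β₁ β₂ β₃ y₁ y₂ y₃ : ℝ) :
    X * ((C y₁ * X ^ d₁ + C y₂ * X ^ d₂ + C y₃ * X ^ d₃) * derivative (C β₁ * X ^ d₁ + C β₂ * X ^ d₂ + C β₃ * X ^ d₃)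
        - 2 * (C β₁ * X ^ d₁ + C β₂ * X ^ d₂ + C β₃ * X ^ d₃)
          * derivative (C y₁ * X ^ d₁ + C y₂ * X ^ d₂ + C y₃ * X ^ d₃))
      = C (-(β₁ * y₁ * (d₁ : ℝ))) * X ^ (2 * d₁)
        + C (β₂ * y₁ * ((d₂ : ℝ) - 2 * d₁) + β₁ * y₂ * ((d₁ : ℝ) - 2 * d₂)) * X ^ (d₁ + d₂)
        + C (-(β₂ * y₂ * (d₂ : ℝ))) * X ^ (2 * d₂)
        + C (β₃ * y₁ * ((d₃ : ℝ) - 2 * d₁) + β₁ * y₃ * ((d₁ : ℝ) - 2 * d₃)) * X ^ (d₁ + d₃)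
        + C (β₃ * y₂ * ((d₃ : ℝ) - 2 * d₂) + β₂ * y₃ * ((d₂ : ℝ) - 2 * d₃)) * X ^ (d₂ + d₃)
        + C (-(β₃ * y₃ * (d₃ : ℝ))) * X ^ (2 * d₃) := by
  have e1 := Literature.Analysis.FluidPDE.Elgindi.X_mul_derivative_X_pow d₁
  have e2 := Literature.Analysis.FluidPDE.Elgindi.X_mul_derivative_X_pow d₂
  have e3 := Literature.Analysis.FluidPDE.Elgindi.X_mul_derivative_X_pow d₃
  have hR : X * derivative (C β₁ * X ^ d₁ + C β₂ * X ^ d₂ + C β₃ * X ^ d₃ : ℝ[X])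
      = C β₁ * (C (d₁ : ℝ) * X ^ d₁) + C β₂ * (C (d₂ : ℝ) * X ^ d₂) + C β₃ * (C (d₃ : ℝ) * X ^ d₃) := by
    rw [← e1, ← e2, ← e3]; simp only [derivative_add, derivative_C_mul]; ring
  have hp : X * derivative (C y₁ * X ^ d₁ + C y₂ * X ^ d₂ + C y₃ * X ^ d₃ : ℝ[X])
      = C y₁ * (C (d₁ : ℝ) * X ^ d₁) + C y₂ * (C (d₂ : ℝ) * X ^ d₂) + C y₃ * (C (d₃ : ℝ) * X ^ d₃) := by
    rw [← e1, ← e2, ← e3]; simp only [derivative_add, derivative_C_mul]; ring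
  calc X * ((C y₁ * X ^ d₁ + C y₂ * X ^ d₂ + C y₃ * X ^ d₃) * derivative (C β₁ * X ^ d₁ + C β₂ * X ^ d₂ + C β₃ * X ^ d₃)
        - 2 * (C β₁ * X ^ d₁ + C β₂ * X ^ d₂ + C β₃ * X ^ d₃)
          * derivative (C y₁ * X ^ d₁ + C y₂ * X ^ d₂ + C y₃ * X ^ d₃))
      = (C y₁ * X ^ d₁ + C y₂ * X ^ d₂ + C y₃ * X ^ d₃)
          * (X * derivative (C β₁ * X ^ d₁ + C β₂ * X ^ d₂ + C β₃ * X ^ d₃))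
        - 2 * (C β₁ * X ^ d₁ + C β₂ * X ^ d₂ + C β₃ * X ^ d₃)
          * (X * derivative (C y₁ * X ^ d₁ + C y₂ * X ^ d₂ + C y₃ * X ^ d₃)) := by
        ring
    _ = _ := by
        rw [hR, hp]
        simp only [map_add, map_mul, map_sub, map_neg, pow_add, two_mul]
        ring

end Summit.ValiantsHypothesis.ValiantsHypothesis.Theorems.LacunarySymmetroidMatrixDescartes.Census
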